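import Summits.AtomisticToContinuum.FouriersLaw.Theses.ParityLiouvilleSeed
import Summits.AtomisticToContinuum.FouriersLaw.Theorems.JunctionLocalitySuperadditiveResistanceDiagonalSplit
import Summits.AtomisticToContinuum.FouriersLaw.Theorems.JunctionLocalitySuperadditiveResistanceDyadicIncrement
import Summits.AtomisticToContinuum.FouriersLaw.Theorems.JunctionLocalitySuperadditiveResistanceEvenDoublingKuboReduction

/-!
# Birth dossier checks for the split of `SuperadditiveResistance` (stmt-AtomisticToContinuum-11748) on route ParityLiouvilleSeed
(strategist s2, 2026-08-17).  Route file rev 3 (commit 36b0c154) carries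
`EvenDoubling` (stmt-19939), `QuasiSubadditiveResistance` (stmt-14041) and the glue item
`SuperadditiveResistance_of_subs` (stmt-19940).  Everything below is BY NAME against those decls; no `sorry`.
-/

namespace Scratch.S2b

open Summit.AtomisticToContinuum.FouriersLaw
open Literature.MathematicalPhysics.KineticTheory.HeatConduction

/-- (1) The glue item stmt-AtomisticToContinuum-19940 closes in one line from the landed split theorem (p150360). -/
theorem glue_closes : Theses.ParityLiouvilleSeed.SuperadditiveResistance_of_subs :=
  Theorems.SuperadditiveResistance.DiagonalSplit.superadditiveResistance_of_subs

/-- (1') hence the parent closes from the two children BY NAME. -/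
theorem parent_of_children (hE : Theses.ParityLiouvilleSeed.EvenDoubling)
    (hQ : Theses.ParityLiouvilleSeed.QuasiSubadditiveResistance) :
    Theses.ParityLiouvilleSeed.SuperadditiveResistance :=
  glue_closes hE hQ

/-- (2) The child is NECESSARY for the parent (p150360). -/
theorem child_of_parent (hA : Theses.ParityLiouvilleSeed.SuperadditiveResistance) :
    Theses.ParityLiouvilleSeed.EvenDoubling :=
  Theorems.SuperadditiveResistance.DiagonalSplit.evenDoubling_of_superadditiveResistance hA

/-- (3) Hypothesis-free equilibrium (Kubo) form of the child, BY NAME (p150384). -/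
theorem child_iff_kuboDoublingBound :
    Theses.ParityLiouvilleSeed.EvenDoubling ↔
      ∀ ω₂ lam β γ T : ℝ, 0 < ω₂ → 0 < lam → 0 < β → 0 < γ → 0 < T →
        ∃ C : ℝ, ∀ N : ℕ, 2 ≤ N →
          ∀ (gN : PhaseSpace N → ℝ) (gL : PhaseSpace (N + N) → ℝ),
            gN ∈ Cruxes.SuperadditiveResistance.FloatingProbeBypassLaplacian.plainForwardFields ω₂ lam β γ T N →
            gL ∈ Cruxes.SuperadditiveResistance.FloatingProbeBypassLaplacian.plainForwardFields ω₂ lam β γ T (N + N) →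
            2 * (1 / Cruxes.SuperadditiveResistance.FloatingProbeBypassLaplacian.plainKubo ω₂ lam β γ T N gN) - C ≤
              1 / Cruxes.SuperadditiveResistance.FloatingProbeBypassLaplacian.plainKubo ω₂ lam β γ T (N + N) gL :=
  Cruxes.SuperadditiveResistance.DiagonalSplitSeriesLaw.evenDoubling_iff_kuboDoublingBound

/-- (4) Increment form modulo the floor (p157807): `ConductanceLowerBound` (stmt-11749, a support item of this very route) and the dyadic
conductivity increment `D_(2N) − D_N ≤ C/N` give the child BY NAME. -/
theorem child_of_increment_of_floor :
    Theses.ParityLiouvilleSeed.ConductanceLowerBound →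
    (∀ ω₂ lam β γ : ℝ, 0 < ω₂ → 0 < lam → 0 < β → 0 < γ → (∀ (N : ℕ) (T_L T_R : ℝ), 0 < T_L → 0 < T_R → ∀ μ ν : MeasureTheory.Measure (Literature.MathematicalPhysics.KineticTheory.HeatConduction.PhaseSpace N), (Literature.MathematicalPhysics.KineticTheory.HeatConduction.pinnedChain ω₂ lam β γ).IsSteadyState N T_L T_R μ → (Literature.MathematicalPhysics.KineticTheory.HeatConduction.pinnedChain ω₂ lam β γ).IsSteadyState N T_L T_R ν → μ = ν) → ∀ μ : (N : ℕ) → ℝ → ℝ → MeasureTheory.Measure (Literature.MathematicalPhysics.KineticTheory.HeatConduction.PhaseSpace N), (∀ (N : ℕ) (T_L T_R : ℝ), 0 < T_L → 0 < T_R → (Literature.MathematicalPhysics.KineticTheory.HeatConduction.pinnedChain ω₂ lam β γ).IsSteadyState N T_L T_R (μ N T_L T_R)) → ∀ T : ℝ, 0 < T → ∀ D : ℕ → ℝ, (∀ N : ℕ, Filter.Tendsto (fun δ : ℝ => (Literature.MathematicalPhysics.KineticTheory.HeatConduction.pinnedChain ω₂ lam β γ).totalCurrent (μ N (T + δ / 2)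 (T - δ / 2)) / δ) (nhdsWithin 0 {(0 : ℝ)}ᶜ) (nhds (D N))) → (∀ N : ℕ, 2 ≤ N → 0 < D N) → ∃ C : ℝ, ∀ N : ℕ, 2 ≤ N → D (N + N) - D N ≤ C / N) →
    Theses.ParityLiouvilleSeed.EvenDoubling :=
  Theorems.SuperadditiveResistance.DyadicIncrement.helper_evenDoublingOfIncrement

end Scratch.S2b
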